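import Summits.ResolutionOfSingularities.ResolutionOfSingularities.Theorems.FrobeniusClosingPatchingRelPerfectDepthOneTargetsDefs

/-!
# Chain W5.2 — typed TARGETS «E» (plan-1 gen 5, CRUX-PLAN v3.2 §6g): the DEPTH-ONE programme r-d1 —
# the PROVED COMPOSITIONS half (definitions in `…DepthOneTargetsDefs.lean`; cell file sha16 `9d67ec503d849faa`)

[OURS · L1 W5.2] Composition theorems only (VERBATIM from the cell file; the Props / structure / inductive they
compose are imported from `…FrobeniusClosingPatchingRelPerfectDepthOneTargetsDefs.lean`, see its module doc for the
gate-forced split); no `sorry`; NOT statements of the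
manuscript under review. Self-contained superset of targets «D» (plan-1 gen 4, cell file
`ChainW52TargetsD.lean`, whose eight declarations are repeated in §1 — verbatim but for the repaired CJS fact
name — so that every seat imports ONE shared specification once this file is landed as
`Theorems/FrobeniusClosingPatchingRelPerfectDepthOneTargets.lean`). The two NAMED FACTS
(`CossartPiltant2019Principalization`, CP 2019 Prop. 4.4 = F-31; `CossartJannsenSaito2020EmbeddedSequenceB`,
CJS 2020 Thm. 1.4 in sequence form WITH boundary and the CORRECTED per-step clause of Thm. 6.9 (a) = F-32bR,
p491949 — the superseded `CossartJannsenSaito2020EmbeddedSequence` (F-32b) is refutable as typed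
(res-L1-w52-tri-2 TRIAGE v4, res-lit-6 ruling 2026-08-27) and is used NOWHERE below) enter ONLY as hypotheses
of the Piece-A targets; everything on the fourfold side (Piece B) is fact-free. Perfectness / residue field /
characteristic / completeness / excellence of `S` are cashed NOWHERE.

## §1 (verbatim from «D», except that the CJS hypothesis is now F-32bR `…EmbeddedSequenceB`)
`HasExceptionalDepthOne`, `IsControlledSeq`, `ControlledTrivialization₃` (Θ₃), `DepthOneConclusion`,
`TrivializationPiece` (A), `DictionaryPiece` (B), `TowerContraction` (D5), `depthOne_of_pieces`.

## §2 Piece B broken into stub-sized targets (NEW)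
* `DepthOneInvariant S I E X i g 𝔟` — the X-side bookkeeping carried along a controlled sequence on the
  exceptional threefold `E`: `X` Noetherian regular over `Spec S` by a blowing up cosupported in the closed
  point, `i : E ⟶ X` a closed immersion with `i.ker` an effective Cartier divisor, `E` regular and mapped
  to the closed point, and the FORMAT `I𝒪_X = M · K` with `M` invertible, `K ⊇ 𝓘_E`, `K|_E = 𝔟`.
* `ExceptionalPackage` (I1: the initial state `X₁ = Bl_𝔪 Spec S ⊃ E₁ ≅ ℙ³_κ`, `I𝒪 = 𝓘_E^d · (𝓘_E + 𝔟̂)`),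
  `DictionaryStep` (D1 at scheme level: one controlled step on `E` is matched by one blowing up of `X`
  preserving the invariant), `DictionaryEnd` (`𝔟 ∈ {⊤, ⊥}` ⇒ `I𝒪_X` locally principal).
* PROVED: `dictionaryEnd_holds : DictionaryEnd`, `inv_along` (induction on `IsControlledSeq`),
  `dictionaryPiece_of_steps(') : ExceptionalPackage → DictionaryStep → (DictionaryEnd →) TowerContraction →
  DictionaryPiece`.

## §3 Piece A broken into stub-sized targets (NEW)
* `PrincipalizeControlled` (A1, consumes CP: controlled sequence to a non-zero LOCALLY PRINCIPAL ideal,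
  keeping the threefold regular / excellent / integral / Noetherian of dimension three),
  `IsRegularDivisorial` + `RegularizeDivisorial` (A2a, consumes CJS-with-boundary: from locally principal to
  a finite product of ideals of REGULAR effective Cartier divisors) `⇐ RegularizeSupport` (A2s, the CJS
  plumbing) `∧ DivisorialFactorization` (S-A2, fact-free), `RegularizePeel` (A2).
* PROVED: `IsControlledSeq.append`, `IsControlledSeq.of_eq`, `peel_of_isRegularDivisorial` (peeling:
  blowing up a regular Cartier component is `𝟙`, `IsBlowup.id`), `regularizeDivisorial_of_support`,
  `regularizePeel_of_divisorial : RegularizeDivisorial → RegularizePeel`, `trivializationPiece_of_steps :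
  PrincipalizeControlled → RegularizePeel → TrivializationPiece`.

## §4 The whole r-d1 from the open stub targets (PROVED compositions)
`depthOne_of_targets : PrincipalizeControlled → RegularizeDivisorial → ExceptionalPackage → DictionaryStep →
TowerContraction → CP → CJS-Seq → DepthOneConclusion` (five targets; `DictionaryEnd` is proved here:
`dictionaryEnd_holds`) and `depthOne_of_targets'` (six: `RegularizeDivisorial ⇐ RegularizeSupport ∧
DivisorialFactorization`).

Tree API the step provers are expected to use (all present 2026-08-27): `exists_isBlowup`,
`IsBlowup.isRegular_of_isRegular_subscheme`, `IsBlowup.exists_isBlowup_comp_supported`,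
`IsBlowup.strictTransformHom` / `strictTransformHom_comp`, `StrictTransformClosedImmersion_holds`,
`controlledTransform`, `IsBlowup.comap_mul_controlledTransform_one`,
`IsBlowup.ker_strictTransformHom_of_maxOrder` (μ = 1) / `…controlledTransform_ker_one_le_ker_strictTransformHom`,
`IsEffectiveCartier.eq_of_mul_eq_mul` (cancellation), `comap_eq_bot_iff_le_ker`, the ring-level D1
dictionary `Theorems.DepthOne.*` (p489709: `map_span_sup_algebraMap_succ/_zero`, `exists_strictTransformEquiv`,
`map_colon_eq_colon_map`), `IsBlowup.isRegular_subscheme_comap` / `isReduced_subscheme_comap` /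
`affineBlowup.isIrreducible_preimage_of_isQuasiRegular`, `exists_ringEquiv_sections_chart_mvPolynomial`,
`Scheme.IsExcellent.of_locallyOfFiniteType`, `atomConclusion_of_companion'`.
-/


noncomputable section

open CategoryTheory CategoryTheory.Limits AlgebraicGeometry TopologicalSpace
open Literature.AlgebraicGeometry.Resolution

set_option linter.dupNamespace false

namespace Summit.ResolutionOfSingularities.ResolutionOfSingularities.Theorems.DepthOneTargets

universe u

/-! ## §1 The depth-one class, controlled sequences, Θ₃, the conclusion, the two pieces (verbatim «D») -/

/-- [OURS · L1 W5.2] **r-d1 from the two pieces** (pure composition, so that Piece A and Piece B can be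
claimed and landed separately). [folklore] -/
theorem depthOne_of_pieces (hA : TrivializationPiece.{u}) (hB : DictionaryPiece.{u})
    (hCP : CossartPiltant2019Principalization.{u})
    (hCJS : CossartJannsenSaito2020EmbeddedSequenceB.{u}) : DepthOneConclusion.{u} :=
  hB (hA hCP hCJS)

/-! ## §1b Two elementary closure properties of controlled sequences (PROVED) -/

/-- Transport of a controlled sequence along equalities of its end ideals. [folklore] -/
theorem IsControlledSeq.of_eq {E' E : Scheme.{u}} {ρ : E' ⟶ E} {𝔟₁ 𝔟₂ : E.IdealSheafData}
    {𝔟₁' 𝔟₂' : E'.IdealSheafData} (h : IsControlledSeq ρ 𝔟₁ 𝔟₁') (h₁ : 𝔟₁ = 𝔟₂) (h₂ : 𝔟₁' = 𝔟₂') :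
    IsControlledSeq ρ 𝔟₂ 𝔟₂' := by
  subst h₁ h₂
  exact h

/-- **Concatenation of controlled sequences** (a controlled sequence on `E'` starting from the end ideal
of a controlled sequence `E' → E` extends it). [folklore] -/
theorem IsControlledSeq.append {E'' E' E : Scheme.{u}} {ρ : E' ⟶ E} {ρ' : E'' ⟶ E'}
    {𝔟 : E.IdealSheafData} {𝔟' : E'.IdealSheafData} {𝔟'' : E''.IdealSheafData}
    (h' : IsControlledSeq ρ' 𝔟' 𝔟'') :
    IsControlledSeq ρ 𝔟 𝔟' → IsControlledSeq (ρ' ≫ ρ) 𝔟 𝔟'' := by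
  induction h' with
  | nil 𝔟₀ =>
      intro h
      simpa only [Category.id_comp] using h
  | cons τ ρ₀ 𝔟₀ 𝔟₁ 𝔟₂ C hseq hC hle hτ hctrl ih =>
      intro h
      rw [Category.assoc]
      exact IsControlledSeq.cons τ (ρ₀ ≫ ρ) 𝔟 𝔟₁ 𝔟₂ C (ih h) hC hle hτ hctrl

/-! ## §2 Piece B (the fourfold dictionary), broken into stub-sized targets -/

/-- `J𝒪_X = 0` iff `J ≤ ker f` (Galois connection `comap ⊣ map`, `map f ⊥ = ker f`). [folklore] -/
theorem comap_eq_bot_iff_le_ker' {X Y : Scheme.{u}} (J : Y.IdealSheafData) (f : X ⟶ Y) :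
    J.comap f = ⊥ ↔ J ≤ f.ker := by
  rw [← le_bot_iff, (Scheme.IdealSheafData.map_gc f).le_iff_le, Scheme.IdealSheafData.map_bot]

/-- [OURS · L1 W5.2] **The dictionary's end holds** (PROVED, so Piece B = I1 + D1 + D5): `𝔟 = ⊤` forces
`K = ⊤` (`Supp K ⊆ Supp 𝓘_E = E` and `E ∩ Supp K = Supp (K|_E) = ∅`), `𝔟 = ⊥` forces `K = 𝓘_E`; in both
cases `I𝒪_X` is a product of effective Cartier ideals. [folklore] -/
theorem dictionaryEnd_holds : DictionaryEnd.{u} := by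
  intro S _ _ I E X i g 𝔟 hinv h𝔟
  obtain ⟨M, K, hM, hiK, hKi, hfmt⟩ := hinv.exists_format
  haveI := hinv.isClosedImmersion
  rw [hfmt]
  rcases h𝔟 with h | h
  · have hK : K = ⊤ := by
      rw [← Scheme.IdealSheafData.support_eq_bot_iff, eq_bot_iff]
      intro x hx
      have hx' : x ∈ (i.ker.support : Set X) := Scheme.IdealSheafData.support_antitone hiK hx
      rw [Scheme.Hom.support_ker, i.isClosedEmbedding.isClosed_range.closure_eq] at hx'
      obtain ⟨e, rfl⟩ := hx'
      have he : e ∈ ((K.comap i).support : Set E) := by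
        rw [Scheme.IdealSheafData.support_comap]
        exact hx
      rw [hKi, h, Scheme.IdealSheafData.support_top] at he
      exact he
    rw [hK, Scheme.IdealSheafData.mul_top]
    exact hM.isLocallyPrincipal
  · have hK : K = i.ker :=
      le_antisymm ((comap_eq_bot_iff_le_ker' K i).mp (hKi.trans h)) hiK
    rw [hK]
    exact hM.isLocallyPrincipal.mul hinv.isEffectiveCartier_ker.isLocallyPrincipal

/-- **The invariant travels along a controlled sequence** (induction on `IsControlledSeq`, one
`DictionaryStep` per blowing up). [folklore] -/
theorem inv_along (hstep : DictionaryStep.{u}) {S : Type u} [CommRing S] [IsRegularLocalRing S]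
    {I : Ideal S} {E' E : Scheme.{u}} {ρ : E' ⟶ E} {𝔟 : E.IdealSheafData} {𝔟' : E'.IdealSheafData}
    (h : IsControlledSeq ρ 𝔟 𝔟') :
    ∀ (X : Scheme.{u}) (i : E ⟶ X) (g : X ⟶ Spec (.of S)), DepthOneInvariant S I E X i g 𝔟 →
      ∃ (X' : Scheme.{u}) (i' : E' ⟶ X') (g' : X' ⟶ Spec (.of S)),
        DepthOneInvariant S I E' X' i' g' 𝔟' := by
  induction h with
  | nil 𝔟₀ => exact fun X i g hinv => ⟨X, i, g, hinv⟩
  | cons τ ρ₀ 𝔟₀ 𝔟₁ 𝔟₂ C hseq hC hle hτ hctrl ih =>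
      intro X i g hinv
      obtain ⟨X', i', g', hinv'⟩ := ih X i g hinv
      exact hstep S I _ X' i' g' 𝔟₁ hinv' _ τ C 𝔟₂ hC hle hτ hctrl

/-- [OURS · L1 W5.2] **Piece B from its stub-sized targets** (PROVED composition): the exceptional
package, the dictionary step, the dictionary's end and the tower contraction give `Θ₃ → DepthOneConclusion`.
If `𝔟 = ⊥` no threefold work is needed; otherwise `Θ₃` trivializes `𝔟` on the (integral, Noetherian,
regular, excellent, three-dimensional) exceptional divisor, the invariant travels along (`inv_along`),
`I𝒪` becomes locally principal on a regular closed-point modification (`DictionaryEnd`), which contracts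
to a companion (`TowerContraction`), and `atomConclusion_of_companion'` concludes. [folklore] -/
theorem dictionaryPiece_of_steps (hpkg : ExceptionalPackage.{u}) (hstep : DictionaryStep.{u})
    (hend : DictionaryEnd.{u}) (hD5 : TowerContraction.{u}) : DictionaryPiece.{u} := by
  intro hΘ S _ _ hdim n x hx I hI hdepth T f hf
  obtain ⟨X, E, g, i, 𝔟, hinv, hint, hnoeth, hexc, hdimE⟩ := hpkg S hdim n x hx I hI hdepth
  have key : ∃ (X' : Scheme.{u}) (g' : X' ⟶ Spec (.of S)),
      (∃ K : (Spec (.of S)).IdealSheafData, IsBlowup g' K ∧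
        (K.support : Set (Spec (.of S))) ⊆ {IsLocalRing.closedPoint S}) ∧
      Scheme.IsRegular X' ∧ IsLocallyPrincipal ((affineBlowup.idealSheaf I).comap g') := by
    by_cases h𝔟 : 𝔟 = ⊥
    · exact ⟨X, g, hinv.exists_isBlowup_supported, hinv.isRegular,
        hend S I E X i g 𝔟 hinv (Or.inr h𝔟)⟩
    · haveI := hint
      haveI := hnoeth
      obtain ⟨E', ρ, hρ⟩ := hΘ E hinv.isRegular_exc hexc hdimE 𝔟 h𝔟
      obtain ⟨X', i', g', hinv'⟩ := inv_along hstep hρ X i g hinv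
      exact ⟨X', g', hinv'.exists_isBlowup_supported, hinv'.isRegular,
        hend S I E' X' i' g' ⊤ hinv' (Or.inl rfl)⟩
  obtain ⟨X', g', ⟨K, hg', hK⟩, hX', hlp⟩ := key
  exact atomConclusion_of_companion' hI (hD5 S I hI X' g' K hg' hK hX' hlp) T f hf

/-- [OURS · L1 W5.2] **Piece B from THREE open targets** (I1, D1, D5), the end being proved. [folklore] -/
theorem dictionaryPiece_of_steps' (hpkg : ExceptionalPackage.{u}) (hstep : DictionaryStep.{u})
    (hD5 : TowerContraction.{u}) : DictionaryPiece.{u} :=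
  dictionaryPiece_of_steps hpkg hstep dictionaryEnd_holds hD5

/-! ## §3 Piece A (the threefold trivialization), broken into stub-sized targets -/

/-- **A2a from A2s and S-A2** (PROVED composition). [folklore] -/
theorem regularizeDivisorial_of_support (hA2s : RegularizeSupport.{u})
    (hfac : DivisorialFactorization.{u}) : RegularizeDivisorial.{u} := by
  intro hCJS E _ _ hreg hexc hdim 𝔟 h𝔟 hlp
  obtain ⟨E', ρ, 𝔟', s, hseq, hint, hnoeth, hreg', h𝔟', hlp', hs, hsupp⟩ :=
    hA2s hCJS E hreg hexc hdim 𝔟 h𝔟 hlp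
  haveI := hint
  haveI := hnoeth
  exact ⟨E', ρ, 𝔟', hseq, hfac E' hreg' 𝔟' h𝔟' hlp' s hs hsupp⟩

/-- **One peeling step**: for an effective Cartier ideal `D` with regular `V(D)`, the identity is a
blowing up along `D` (`IsBlowup.id`) and `D · 𝔟'` has controlled transform `𝔟'`. [folklore] -/
theorem IsControlledSeq.peel_step {E : Scheme.{u}} (D 𝔟' : E.IdealSheafData) (hD : IsEffectiveCartier D)
    (hDreg : Scheme.IsRegular D.subscheme) : IsControlledSeq (𝟙 E ≫ 𝟙 E) (D * 𝔟') 𝔟' := by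
  refine IsControlledSeq.cons (𝟙 E) (𝟙 E) (D * 𝔟') (D * 𝔟') 𝔟' D (IsControlledSeq.nil _) hDreg ?_
    (IsBlowup.id hD) ?_
  · exact Scheme.IdealSheafData.le_def.mpr fun U =>
      show D.ideal U * 𝔟'.ideal U ≤ D.ideal U from Ideal.mul_le_right
  · simp only [Scheme.IdealSheafData.comap_id]

/-- **Peeling** (PROVED): a regular-divisorial ideal sheaf is controlled-trivialized, one regular Cartier
component at a time (each step an isomorphism). [cite: Kollar2007, (3.111) Step 3] -/
theorem peel_of_isRegularDivisorial {E : Scheme.{u}} {𝔟 : E.IdealSheafData} (h : IsRegularDivisorial 𝔟) :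
    ∃ (E' : Scheme.{u}) (ρ : E' ⟶ E), IsControlledSeq ρ 𝔟 ⊤ := by
  obtain ⟨l, hl, rfl⟩ := h
  induction l with
  | nil => exact ⟨E, 𝟙 E, by simpa using IsControlledSeq.nil (⊤ : E.IdealSheafData)⟩
  | cons D l ih =>
      obtain ⟨E', ρ, hρ⟩ := ih fun D' hD' => hl D' (List.mem_cons_of_mem D hD')
      obtain ⟨hD, hDreg⟩ := hl D (List.mem_cons_self)
      refine ⟨E', ρ ≫ (𝟙 E ≫ 𝟙 E), ?_⟩
      rw [List.prod_cons]
      exact hρ.append (IsControlledSeq.peel_step D l.prod hD hDreg)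

/-- **A2 from A2a** (PROVED): regularize the support (CJS), then peel. [folklore] -/
theorem regularizePeel_of_divisorial (hA2a : RegularizeDivisorial.{u}) : RegularizePeel.{u} := by
  intro hCJS E _ _ hreg hexc hdim 𝔟 h𝔟 hlp
  obtain ⟨E', ρ, 𝔟', hseq, hdiv⟩ := hA2a hCJS E hreg hexc hdim 𝔟 h𝔟 hlp
  obtain ⟨E'', ρ', hseq'⟩ := peel_of_isRegularDivisorial hdiv
  exact ⟨E'', ρ' ≫ ρ, hseq'.append hseq⟩

/-- [OURS · L1 W5.2] **Piece A from its stub-sized targets** (PROVED composition): principalize (CP),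
then regularize-and-peel (CJS), concatenating the controlled sequences. [folklore] -/
theorem trivializationPiece_of_steps (hA1 : PrincipalizeControlled.{u}) (hA2 : RegularizePeel.{u}) :
    TrivializationPiece.{u} := by
  intro hCP hCJS E _ _ hreg hexc hdim 𝔟 h𝔟
  obtain ⟨E', ρ, 𝔟', hseq, hlp, h𝔟', hint, hnoeth, hreg', hexc', hdim'⟩ :=
    hA1 hCP E hreg hexc hdim 𝔟 h𝔟
  haveI := hint
  haveI := hnoeth
  obtain ⟨E'', ρ', hseq'⟩ := hA2 hCJS E' hreg' hexc' hdim' 𝔟' h𝔟' hlp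
  exact ⟨E'', ρ' ≫ ρ, hseq'.append hseq⟩

/-! ## §4 The depth-one rung from the five open targets (PROVED composition) -/

/-- [OURS · L1 W5.2] **r-d1 from the FIVE open stub targets**: A1 `PrincipalizeControlled`, A2a
`RegularizeDivisorial`, I1 `ExceptionalPackage`, D1 `DictionaryStep`, D5 `TowerContraction`, and the two
named facts as hypotheses (the dictionary's end and the peeling are proved in this file). [folklore] -/
theorem depthOne_of_targets (hA1 : PrincipalizeControlled.{u}) (hA2a : RegularizeDivisorial.{u})
    (hpkg : ExceptionalPackage.{u}) (hstep : DictionaryStep.{u}) (hD5 : TowerContraction.{u})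
    (hCP : CossartPiltant2019Principalization.{u})
    (hCJS : CossartJannsenSaito2020EmbeddedSequenceB.{u}) : DepthOneConclusion.{u} :=
  depthOne_of_pieces (trivializationPiece_of_steps hA1 (regularizePeel_of_divisorial hA2a))
    (dictionaryPiece_of_steps' hpkg hstep hD5) hCP hCJS

/-- [OURS · L1 W5.2] **r-d1 from the SIX finest open targets** (A1 `PrincipalizeControlled`, A2s
`RegularizeSupport`, S-A2 `DivisorialFactorization`, I1 `ExceptionalPackage`, D1 `DictionaryStep`, D5
`TowerContraction`) and the two named facts. [folklore] -/
theorem depthOne_of_targets' (hA1 : PrincipalizeControlled.{u}) (hA2s : RegularizeSupport.{u})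
    (hfac : DivisorialFactorization.{u}) (hpkg : ExceptionalPackage.{u}) (hstep : DictionaryStep.{u})
    (hD5 : TowerContraction.{u}) (hCP : CossartPiltant2019Principalization.{u})
    (hCJS : CossartJannsenSaito2020EmbeddedSequenceB.{u}) : DepthOneConclusion.{u} :=
  depthOne_of_targets hA1 (regularizeDivisorial_of_support hA2s hfac) hpkg hstep hD5 hCP hCJS

end Summit.ResolutionOfSingularities.ResolutionOfSingularities.Theorems.DepthOneTargets

end
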